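import Mathlib
import Literature.Barriers.PneNP.TSPExtensionComplexityMatchings
import HarnessLib

/-!
# Symmetric SDP formulations and the matching problem (Braun–Brown-Cohen–Huq–Pokutta–Raghavendra–Roy–Weitz–Zink 2016)

G. Braun, J. Brown-Cohen, A. Huq, S. Pokutta, P. Raghavendra, A. Roy, B. Weitz, D. Zink, *The
matching problem has no small symmetric SDP*, SODA 2016 / Math. Program. 165 (2017) 643–662
(arXiv:1504.00703; held `paper:arxiv-1504.00703`, locators = pages of that rendering) [BraunEtAl2016].
The SDP-formulation framework is that of Braun–Pokutta–Zink, *Inapproximability of combinatorial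
problems via small LPs and SDPs*, STOC 2015 [BraunPokuttaZink2015], extended by a symmetry condition.

This file TYPES the framework (real definitions) and records the paper's main theorem as a NAMED
FACT (not proved here):

* `MaxProblem σ φ` — "A maximization problem `𝒫 = (𝒮, ℱ)` consists of a set `𝒮` of feasible
  solutions and a set `ℱ` of objective functions", together with "approximation guarantees"
  `C̃, S̃ : ℱ → ℝ` (§2, p. 5); `MaxProblem.Sound f` is the printed side condition
  "`max_{s ∈ 𝒮} f(s) ≤ S̃(f)`"; `MaxProblem.IsSymmetric` is "`𝒫` is `G`-symmetric"
  ("`(g · f)(g · s) = f(s)`", "`C̃(g · f) = C̃(f)` and `S̃(g · f) = S̃(f)`").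
* `SDPFormulation P d` — **Definition 2.2** (p. 5), "a `(C̃, S̃)`-approximate SDP formulation of `𝒫`
  of size `d`": "a linear map `𝒜 : 𝕊^d → ℝ^k` and `b ∈ ℝ^k` together with (Feasible solutions) an
  `X^s ∈ 𝕊^d_+` with `𝒜(X^s) = b` for all `s ∈ 𝒮` …, (Objective functions) an affine function
  `w^f : 𝕊^d → ℝ` satisfying `w^f(X^s) = f(s)` for all `f ∈ ℱ` with `max_{s∈𝒮} f(s) ≤ S̃(f)` and all
  `s ∈ 𝒮` …, (Achieving guarantee) `max {w^f(X) | 𝒜(X) = b, X ∈ 𝕊^d_+} ≤ C̃(f)` for all `f ∈ ℱ`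
  with `max_{s∈𝒮} f(s) ≤ S̃(f)`."
* `SDPFormulation.IsCoordSymmetric E ρ` — same definition, "`G`-coordinate-symmetric": `G` acts
  on `[d]` (a homomorphism `ρ : G →* Perm (Fin d)`), hence on `𝕊^d` by
  "`(g · X)_{ij} = X_{g⁻¹·i, g⁻¹·j}`" (`permAct`), and "Action on solutions: `X^{g·s} = g · X^s`",
  "Action on functions: `w^{g·f}(g · X) = w^f(X)` for all `f` with `max f ≤ S̃(f)`", "Invariant
  affine space: `𝒜(g · X) = 𝒜(X)`".
* `pmProblem n ε` — **§4** (p. 7): "The feasible solutions of `PM_n` are all the perfect matchings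
  `M` on `K_n`. The objective functions `f_F` are indexed by the edge sets `F` of `K_n`: …
  `f_F(M) := |M ∩ F|`. For approximation guarantees we use `S̃(f) := max f` and
  `C̃(f) := max f + ε/2` for some fixed `0 ≤ ε < 1`"; the alternating group `A_n` acts by
  permuting vertices (§4.5). Proved here: the problem is `Sym(Fin n)`- (hence `A_n`-) symmetric
  (`pmProblem_isSymmetric`), and every objective is sound (`pmProblem_sound`).
* `BraunEtAl2016_symmetricSDP_matching` — **Theorem 4.10 (Main)** (p. 9), verbatim: "There exists an
  absolute constant `α > 0` such that for all even `n` and every `0 ≤ ε < 1`, every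
  `A_n`-coordinate-symmetric SDP extended formulation approximating the perfect matching problem
  `PM_n` within a factor of `1 − ε/(n−1)` has size at least `2^{αn}`."  The factor `1 − ε/(n−1)`
  is the paper's reading of the guarantee pair `(C̃, S̃) = (max f + ε/2, max f)` on odd sets (last
  lines of the proof, p. 10); the fact is stated for that guarantee pair, which is what is proved.
  The proof "Fix an even integer `n ≥ 10` … `k = ⌈βn⌉` … suppose `d < √C(n,k) − 1`" and ends in
  Grigoriev's asymptotic bound (Thm 4.11 = [Grigoriev2001TCS, Cor. 2], in the tree as the named
  fact `Literature.Computability.Complexity.Grigoriev2001_mod2Degree`); accordingly the `Ω` is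
  unfolded here with a threshold `n₀` ("for all even `n ≥ n₀`"), a consequence of the printed form.

Proof architecture (NOT reproduced; pointers for a later discharge modulo Grigoriev): Lemma 2.3
(SDP duality "as in [BraunPokuttaZink2015]" + `√X`: a symmetric formulation of size `d` gives a
`G`-invariant family `ℋ` of `≤ C(d+1,2)` functions with `C̃(f) − f = Σ_j h_j² + μ_f`,
`h_j ∈ span ℋ`); Lemma 4.1 (matchings agreeing on `E[S]`, `|S| < n/2`, are `A([n]∖S)`-conjugate);
Lemma 4.2 (Dixon–Mortimer Thm 5.2A; the tree PROVES the `Sym` form Thm 5.2B as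
`Literature.GroupTheory.PermutationGroups.alternating_fixing_le_of_index_lt_choose`); Prop. 4.3
(symmetric families are juntas); Thm 4.9 (degree-`(2d−1)` derivations from the matching
constraints `𝒫_n = {x_{uv}x_{uw}} ∪ {Σ_u x_{uv} − 1} ∪ {x_{uv}² − x_{uv}}`); §4.5 substitution
`K_n → K_m`, `m ∈ {n/2, n/2 − 1}` odd, producing a degree-`(2k−1)` sum-of-squares refutation of
"`K_m` has a perfect matching".

Rendering decisions. `𝕊^d` is rendered as all real `d × d` matrices (`𝒜`, `w^f` linear maps on
`Matrix (Fin d) (Fin d) ℝ`; psd = Mathlib `Matrix.PosSemidef`, which includes symmetry) — a linear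
map on symmetric matrices extends to all matrices, so nothing changes; an affine `w^f` is a linear
map `w f` plus a constant `c f`; "`max {…} ≤ C̃(f)`" is "every feasible `X` has `w^f(X) ≤ C̃(f)`";
`max f` over the (finite) solution set is `sSup (range f)`.  Perfect matchings of `K_n` are the
tree's edge sets `Literature.Barriers.PneNP.IsPMOn univ M` (`TSPExtensionComplexityMatchings.lean`,
the vocabulary of the Rothvoß files); objective indices are edge sets `F` of `K_n` (no loops,
`EdgeSet n`).  Group actions are Mathlib `MulAction`s; the instances declared here are on this
file's own types `PMSol n`, `EdgeSet n` only.
-/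

noncomputable section

open Finset Matrix

namespace Literature.Combinatorics.Optimization

/-! ### Maximization problems with approximation guarantees -/

/-- A **maximization problem** `𝒫 = (𝒮, ℱ)` with approximation guarantees: feasible solutions
`s : σ`, objective functions indexed by `f : φ` with values `val f s = f(s)`, and the guarantees
`C̃ = C`, `S̃ = S : ℱ → ℝ`. [cite: BraunEtAl2016, §2 (p. 5)] -/
structure MaxProblem (σ : Type*) (φ : Type*) where
  /-- `f(s)`: the value of the objective function `f` at the feasible solution `s`. -/
  val : φ → σ → ℝ
  /-- the completeness guarantee `C̃(f)`. -/
  C : φ → ℝ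
  /-- the soundness guarantee `S̃(f)`. -/
  S : φ → ℝ

namespace MaxProblem

variable {σ φ : Type*}

/-- The side condition "`max_{s ∈ 𝒮} f(s) ≤ S̃(f)`" under which a formulation must be exact on `f`
and achieve `C̃(f)`. [cite: BraunEtAl2016, Def. 2.2 (p. 5)] -/
def Sound (P : MaxProblem σ φ) (f : φ) : Prop :=
  ∀ s, P.val f s ≤ P.S f

/-- "The problem `𝒫` is `G`-symmetric if the group action satisfies the compatibility constraint
`(g · f)(g · s) = f(s)`. For a `G`-symmetric problem we require `G`-symmetric approximation
guarantees: `C̃(g · f) = C̃(f)` and `S̃(g · f) = S̃(f)`." [cite: BraunEtAl2016, §2 (p. 5)] -/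
structure IsSymmetric (P : MaxProblem σ φ) (G : Type*) [Group G] [MulAction G σ] [MulAction G φ] :
    Prop where
  /-- compatibility `(g · f)(g · s) = f(s)` -/
  val_smul : ∀ (g : G) (f : φ) (s : σ), P.val (g • f) (g • s) = P.val f s
  /-- `C̃(g · f) = C̃(f)` -/
  C_smul : ∀ (g : G) (f : φ), P.C (g • f) = P.C f
  /-- `S̃(g · f) = S̃(f)` -/
  S_smul : ∀ (g : G) (f : φ), P.S (g • f) = P.S f

/-- A symmetric problem is symmetric for every subgroup (immediate from the definition).
[cite: BraunEtAl2016, §2 (p. 5)] -/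
theorem IsSymmetric.subgroup {P : MaxProblem σ φ} {G : Type*} [Group G] [MulAction G σ]
    [MulAction G φ] (h : P.IsSymmetric G) (H : Subgroup G) : P.IsSymmetric H :=
  ⟨fun g f s => h.val_smul (g : G) f s, fun g f => h.C_smul (g : G) f,
    fun g f => h.S_smul (g : G) f⟩

/-- Sound objectives are stable under the action of a symmetry group (immediate from the
definition). [cite: BraunEtAl2016, §2 (p. 5)] -/
theorem IsSymmetric.sound_smul {P : MaxProblem σ φ} {G : Type*} [Group G] [MulAction G σ]
    [MulAction G φ] (h : P.IsSymmetric G) {f : φ} (hf : P.Sound f) (g : G) : P.Sound (g • f) := by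
  intro s
  have := hf (g⁻¹ • s)
  rwa [← h.val_smul g f (g⁻¹ • s), smul_inv_smul, ← h.S_smul g f] at this

end MaxProblem

/-! ### SDP formulations (Definition 2.2) -/

/-- The coordinate action of a permutation `π` of `[d]` on `d × d` matrices:
`(π · X)_{ij} = X_{π⁻¹ i, π⁻¹ j}`. [cite: BraunEtAl2016, Def. 2.2 (p. 5, "coordinate-symmetric")] -/
def permAct {d : ℕ} (π : Equiv.Perm (Fin d)) (X : Matrix (Fin d) (Fin d) ℝ) :
    Matrix (Fin d) (Fin d) ℝ :=
  X.submatrix ⇑(π⁻¹) ⇑(π⁻¹)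

/-- Entries of `permAct`. [cite: BraunEtAl2016, Def. 2.2 (p. 5)] -/
@[simp] theorem permAct_apply {d : ℕ} (π : Equiv.Perm (Fin d)) (X : Matrix (Fin d) (Fin d) ℝ)
    (i j : Fin d) : permAct π X i j = X (π⁻¹ i) (π⁻¹ j) := rfl

/-- `permAct` is a (left) action: `permAct 1 = id`. [cite: BraunEtAl2016, Def. 2.2 (p. 5)] -/
@[simp] theorem permAct_one {d : ℕ} (X : Matrix (Fin d) (Fin d) ℝ) : permAct 1 X = X := by
  ext i j; simp

/-- `permAct` is a (left) action: `permAct (π τ) = permAct π ∘ permAct τ`.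
[cite: BraunEtAl2016, Def. 2.2 (p. 5)] -/
theorem permAct_mul {d : ℕ} (π τ : Equiv.Perm (Fin d)) (X : Matrix (Fin d) (Fin d) ℝ) :
    permAct (π * τ) X = permAct π (permAct τ X) := by
  ext i j; simp [_root_.mul_inv_rev, Equiv.Perm.mul_apply]

/-- The coordinate action preserves positive semidefiniteness ("`G` acts on `𝕊^d_+`").
[cite: BraunEtAl2016, Def. 2.2 (p. 5)] -/
theorem posSemidef_permAct {d : ℕ} (π : Equiv.Perm (Fin d)) {X : Matrix (Fin d) (Fin d) ℝ}
    (hX : X.PosSemidef) : (permAct π X).PosSemidef :=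
  hX.submatrix _

/-- **Definition 2.2 (SDP formulation for `𝒫`).** A `(C̃, S̃)`-approximate SDP formulation of the
maximization problem `P` of **size `d`**: a linear map `𝒜 : 𝕊^d → ℝ^k` and `b ∈ ℝ^k`; for every
feasible solution `s` a psd matrix `X^s` with `𝒜(X^s) = b`; for every objective `f` an affine
function `w^f = w f + c f` on `𝕊^d` which is exact on solutions (`w^f(X^s) = f(s)`) for the sound
`f`, and which achieves the guarantee: every `X ⪰ 0` with `𝒜(X) = b` has `w^f(X) ≤ C̃(f)`, for the
sound `f`. [cite: BraunEtAl2016, Def. 2.2 (p. 5)] -/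
structure SDPFormulation {σ φ : Type*} (P : MaxProblem σ φ) (d : ℕ) where
  /-- number of linear equality constraints -/
  k : ℕ
  /-- the linear map `𝒜 : 𝕊^d → ℝ^k` -/
  A : Matrix (Fin d) (Fin d) ℝ →ₗ[ℝ] (Fin k → ℝ)
  /-- the right-hand side `b ∈ ℝ^k` -/
  b : Fin k → ℝ
  /-- the feasible solutions' psd matrices `X^s` -/
  X : σ → Matrix (Fin d) (Fin d) ℝ
  /-- `X^s ∈ 𝕊^d_+` -/
  posSemidef_X : ∀ s, (X s).PosSemidef
  /-- `𝒜(X^s) = b` -/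
  A_X : ∀ s, A (X s) = b
  /-- linear part of the affine objective `w^f` -/
  w : φ → Matrix (Fin d) (Fin d) ℝ →ₗ[ℝ] ℝ
  /-- constant part of the affine objective `w^f` -/
  c : φ → ℝ
  /-- "the linearizations are exact on solutions": `w^f(X^s) = f(s)` for sound `f` -/
  exact : ∀ f, P.Sound f → ∀ s, w f (X s) + c f = P.val f s
  /-- "achieving guarantee": `max {w^f(X) | 𝒜(X) = b, X ⪰ 0} ≤ C̃(f)` for sound `f` -/
  achieves : ∀ f, P.Sound f → ∀ Y : Matrix (Fin d) (Fin d) ℝ, Y.PosSemidef → A Y = b →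
    w f Y + c f ≤ P.C f

/-- **`G`-coordinate-symmetric SDP formulation** (Definition 2.2, continued): `G` acts on `[d]`
through `ρ`, hence on `𝕊^d` by coordinate permutation `permAct (ρ g)`, and the formulation
satisfies "Action on solutions: `X^{g·s} = g · X^s`", "Action on functions:
`w^{g·f}(g · X) = w^f(X)` for all `f` with `max f ≤ S̃(f)`", "Invariant affine space:
`𝒜(g · X) = 𝒜(X)`". [cite: BraunEtAl2016, Def. 2.2 (p. 5)] -/
structure SDPFormulation.IsCoordSymmetric {σ φ : Type*} {P : MaxProblem σ φ} {d : ℕ}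
    (E : SDPFormulation P d) {G : Type*} [Group G] [MulAction G σ] [MulAction G φ]
    (ρ : G →* Equiv.Perm (Fin d)) : Prop where
  /-- `X^{g·s} = g · X^s` -/
  X_smul : ∀ (g : G) (s : σ), E.X (g • s) = permAct (ρ g) (E.X s)
  /-- `w^{g·f}(g · X) = w^f(X)` for sound `f` -/
  w_smul : ∀ (g : G) (f : φ), P.Sound f → ∀ Y : Matrix (Fin d) (Fin d) ℝ,
    E.w (g • f) (permAct (ρ g) Y) + E.c (g • f) = E.w f Y + E.c f
  /-- `𝒜(g · X) = 𝒜(X)` -/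
  A_smul : ∀ (g : G) (Y : Matrix (Fin d) (Fin d) ℝ), E.A (permAct (ρ g) Y) = E.A Y

/-! ### The perfect matching problem `PM_n` (§4) -/

open Literature.Barriers.PneNP

/-- The feasible solutions of `PM_n`: "all the perfect matchings `M` on `K_n`", as edge sets
(`IsPMOn univ M`). [cite: BraunEtAl2016, §4 (p. 7)] -/
abbrev PMSol (n : ℕ) : Type := {M : Finset (Sym2 (Fin n)) // IsPMOn (univ : Finset (Fin n)) M}

/-- The objective indices of `PM_n`: "the edge sets `F` of `K_n`" (sets of non-loop pairs).
[cite: BraunEtAl2016, §4 (p. 7)] -/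
@[ext] structure EdgeSet (n : ℕ) where
  /-- the edges -/
  edges : Finset (Sym2 (Fin n))
  /-- no loops: `F ⊆ C([n], 2)` -/
  not_isDiag : ∀ e ∈ edges, ¬e.IsDiag

variable {n : ℕ}

/-- Relabelling a pair by an injective map preserves being a non-loop. [folklore] -/
private theorem Sym2.isDiag_map_iff {α β : Type*} {f : α → β} (hf : Function.Injective f) (e : Sym2 α) :
    (Sym2.map f e).IsDiag ↔ e.IsDiag := by
  induction e using Sym2.ind with
  | h a b => simp [hf.eq_iff]

/-- Relabelling the vertices of `K_n` by a permutation maps perfect matchings to perfect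
matchings ("`A_n` acts naturally on `PM_n` via permutation of vertices").
[cite: BraunEtAl2016, §4.5 (p. 9)] -/
theorem isPMOn_univ_image_map (π : Equiv.Perm (Fin n)) {M : Finset (Sym2 (Fin n))}
    (hM : IsPMOn (univ : Finset (Fin n)) M) :
    IsPMOn (univ : Finset (Fin n)) (M.image (Sym2.map π)) := by
  refine ⟨fun e _ => Finset.mem_sym2_iff.mpr fun a _ => mem_univ a, ?_, ?_⟩
  · intro e he
    obtain ⟨e', he', rfl⟩ := mem_image.mp he
    rw [Sym2.isDiag_map_iff π.injective]
    exact hM.2.1 e' he'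
  · intro v _
    have hfilter : (M.image (Sym2.map π)).filter (fun e => v ∈ e) =
        (M.filter fun e => π.symm v ∈ e).image (Sym2.map π) := by
      rw [Finset.filter_image]
      congr 1
      refine Finset.filter_congr fun e _ => ?_
      rw [Sym2.mem_map]
      constructor
      · rintro ⟨a, ha, hav⟩
        rwa [← hav, Equiv.symm_apply_apply]
      · intro h
        exact ⟨π.symm v, h, π.apply_symm_apply v⟩
    rw [hfilter, card_image_of_injective _ (Sym2.map.injective π.injective)]
    exact hM.2.2 (π.symm v) (mem_univ _)

/-- `Sym(Fin n)` acts on perfect matchings by relabelling vertices: `π · M = {π(e) : e ∈ M}`.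
[cite: BraunEtAl2016, §4.5 ("`A_n` acts naturally on `PM_n` via permutation of vertices")] -/
instance PMSol.instMulAction : MulAction (Equiv.Perm (Fin n)) (PMSol n) where
  smul π M := ⟨M.1.image (Sym2.map π), isPMOn_univ_image_map π M.2⟩
  one_smul M := Subtype.ext <| by
    change M.1.image (Sym2.map ⇑(1 : Equiv.Perm (Fin n))) = M.1
    rw [Equiv.Perm.coe_one, Sym2.map_id, image_id]
  mul_smul π τ M := Subtype.ext <| by
    change M.1.image (Sym2.map ⇑(π * τ)) = (M.1.image (Sym2.map τ)).image (Sym2.map π)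
    rw [Equiv.Perm.coe_mul, Sym2.map_comp, image_image]

/-- Unfolding of the action on perfect matchings. [cite: BraunEtAl2016, §4.5 (p. 9)] -/
theorem PMSol.smul_val (π : Equiv.Perm (Fin n)) (M : PMSol n) :
    (π • M).1 = M.1.image (Sym2.map π) := rfl

/-- `Sym(Fin n)` acts on edge sets by relabelling vertices. [cite: BraunEtAl2016, §4.5] -/
instance EdgeSet.instMulAction : MulAction (Equiv.Perm (Fin n)) (EdgeSet n) where
  smul π F := ⟨F.edges.image (Sym2.map π), fun e he => by
    obtain ⟨e', he', rfl⟩ := mem_image.mp he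
    rw [Sym2.isDiag_map_iff π.injective]
    exact F.not_isDiag e' he'⟩
  one_smul F := EdgeSet.ext <| by
    change F.edges.image (Sym2.map ⇑(1 : Equiv.Perm (Fin n))) = F.edges
    rw [Equiv.Perm.coe_one, Sym2.map_id, image_id]
  mul_smul π τ F := EdgeSet.ext <| by
    change F.edges.image (Sym2.map ⇑(π * τ)) = (F.edges.image (Sym2.map τ)).image (Sym2.map π)
    rw [Equiv.Perm.coe_mul, Sym2.map_comp, image_image]

/-- Unfolding of the action on edge sets. [cite: BraunEtAl2016, §4.5 (p. 9)] -/
theorem EdgeSet.smul_edges (π : Equiv.Perm (Fin n)) (F : EdgeSet n) :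
    (π • F).edges = F.edges.image (Sym2.map π) := rfl

/-- The objective `f_F(M) := |M ∩ F|`. [cite: BraunEtAl2016, §4 (p. 7)] -/
def pmVal (F : EdgeSet n) (M : PMSol n) : ℝ :=
  ((M.1 ∩ F.edges).card : ℝ)

/-- `max f_F = max_M |M ∩ F|` over the perfect matchings of `K_n` (the supremum of a finite set of
values; `0` if `n` is odd and there is no perfect matching — the paper takes `n` even).
[cite: BraunEtAl2016, §4 (p. 7, "S̃(f) := max f")] -/
def pmMax (F : EdgeSet n) : ℝ :=
  sSup (Set.range (pmVal F))

/-- **The perfect matching problem `PM_n`** as a maximization problem with the guarantees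
"`S̃(f) := max f` and `C̃(f) := max f + ε/2`". [cite: BraunEtAl2016, §4 (p. 7)] -/
def pmProblem (n : ℕ) (ε : ℝ) : MaxProblem (PMSol n) (EdgeSet n) where
  val := pmVal
  C F := pmMax F + ε / 2
  S F := pmMax F

/-- Unfolding lemmas for `pmProblem`. [cite: BraunEtAl2016, §4 (p. 7)] -/
@[simp] theorem pmProblem_val (ε : ℝ) (F : EdgeSet n) (M : PMSol n) :
    (pmProblem n ε).val F M = ((M.1 ∩ F.edges).card : ℝ) := rfl

/-- `S̃(f_F) = max f_F`. [cite: BraunEtAl2016, §4 (p. 7)] -/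
@[simp] theorem pmProblem_S (ε : ℝ) (F : EdgeSet n) : (pmProblem n ε).S F = pmMax F := rfl

/-- `C̃(f_F) = max f_F + ε/2`. [cite: BraunEtAl2016, §4 (p. 7)] -/
@[simp] theorem pmProblem_C (ε : ℝ) (F : EdgeSet n) :
    (pmProblem n ε).C F = pmMax F + ε / 2 := rfl

/-- Every objective of `PM_n` is sound: `f_F(M) ≤ max f_F` (`S̃(f) = max f`), so Definition 2.2's
exactness and guarantee conditions apply to ALL objectives. [cite: BraunEtAl2016, §4 (p. 7)] -/
theorem pmProblem_sound (ε : ℝ) (F : EdgeSet n) : (pmProblem n ε).Sound F :=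
  fun M => le_csSup (Set.finite_range (pmVal F)).bddAbove ⟨M, rfl⟩

/-- The objective values are invariant: `f_{π F}(π M) = f_F(M)`. [cite: BraunEtAl2016, §4.5 (p. 9)] -/
theorem pmVal_smul (π : Equiv.Perm (Fin n)) (F : EdgeSet n) (M : PMSol n) :
    pmVal (π • F) (π • M) = pmVal F M := by
  unfold pmVal
  rw [PMSol.smul_val, EdgeSet.smul_edges,
    ← image_inter _ _ (Sym2.map.injective π.injective),
    card_image_of_injective _ (Sym2.map.injective π.injective)]

/-- The maxima are invariant: `max f_{π F} = max f_F`. [cite: BraunEtAl2016, §4.5 (p. 9)] -/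
theorem pmMax_smul (π : Equiv.Perm (Fin n)) (F : EdgeSet n) : pmMax (π • F) = pmMax F := by
  unfold pmMax
  have : pmVal (π • F) = pmVal F ∘ fun M => π⁻¹ • M := by
    funext M
    simp only [Function.comp_apply]
    conv_lhs => rw [← smul_inv_smul π M]
    exact pmVal_smul π F (π⁻¹ • M)
  rw [this, (MulAction.bijective π⁻¹).surjective.range_comp]

/-- **`PM_n` is `Sym(Fin n)`-symmetric** (hence `A_n`-symmetric): "the guarantees `C̃, S̃` are
`A_n`-symmetric in the sense defined in Section 2". [cite: BraunEtAl2016, §4.5 (p. 9)] -/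
theorem pmProblem_isSymmetric (n : ℕ) (ε : ℝ) :
    (pmProblem n ε).IsSymmetric (Equiv.Perm (Fin n)) where
  val_smul π F M := pmVal_smul π F M
  C_smul π F := by simp [pmMax_smul]
  S_smul π F := pmMax_smul π F

/-- `PM_n` is `A_n`-symmetric. [cite: BraunEtAl2016, §4.5 (p. 9)] -/
theorem pmProblem_isSymmetric_alternating (n : ℕ) (ε : ℝ) :
    (pmProblem n ε).IsSymmetric (alternatingGroup (Fin n)) :=
  (pmProblem_isSymmetric n ε).subgroup _

/-! ### The named fact -/

/-- **Braun–Brown-Cohen–Huq–Pokutta–Raghavendra–Roy–Weitz–Zink 2016, Theorem 4.10 (Main).**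
"There exists an absolute constant `α > 0` such that for all even `n` and every `0 ≤ ε < 1`, every
`A_n`-coordinate-symmetric SDP extended formulation approximating the perfect matching problem
`PM_n` within a factor of `1 − ε/(n−1)` has size at least `2^{αn}`."  Recorded form: there are
`α > 0` and a threshold `n₀` such that for every even `n ≥ n₀`, every `ε ∈ [0,1)`, every size `d`,
every `(max f + ε/2, max f)`-approximate SDP formulation `E` of `PM_n` of size `d` (Def. 2.2) that
is `A_n`-coordinate-symmetric for some action `ρ` of `A_n = alternatingGroup (Fin n)` on `[d]`
satisfies `2^{αn} ≤ d`.  (The threshold unfolds the asymptotic constant of Grigoriev's degree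
bound used in the proof, Thm. 4.11 = `Literature.Computability.Complexity.Grigoriev2001_mod2Degree`;
the printed "for all even `n`" implies this form.)  The symmetric case of the open question
"does the matching polytope have a small SDP?" (§1, p. 3).
[cite: BraunEtAl2016, Thm. 4.10 (p. 9)] -/
def BraunEtAl2016_symmetricSDP_matching : Prop :=
  ∃ α : ℝ, 0 < α ∧ ∃ n₀ : ℕ, ∀ n : ℕ, n₀ ≤ n → Even n → ∀ ε : ℝ, 0 ≤ ε → ε < 1 →
    ∀ (d : ℕ) (E : SDPFormulation (pmProblem n ε) d)
      (ρ : alternatingGroup (Fin n) →* Equiv.Perm (Fin d)),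
      E.IsCoordSymmetric ρ → (2 : ℝ) ^ (α * n) ≤ d

end Literature.Combinatorics.Optimization
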